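import Summits.ValiantsHypothesis.ValiantsHypothesis.Theorems.KPlusLogSqLawValuativeDoorAPFreeLaw

/-!
# LINE `valuative_door` (crux `WeakLifting`, stmt-ValiantsHypothesis-19561) — THE PROPAGATION ENGINE FOR GENERAL SUPPORTS:
# classes without a diagonal cell propagate exactly as on AP-free supports

HONEST FRAMING.  Helper (cell `pub-symmetroid`, seat val-sym-lift-p1 g25, 2026-08-29; `--supports 19561 --as helper`).  Width two, ALL `K`,
every field, every non-archimedean `v`.  ✓ `…RoofEngine` / ✓ `…RoofExcess` / ✓ `…APFreeLaw` (this seat) prove the AP-FREE LAW with a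
GLOBAL «no three-term progression» hypothesis.  That hypothesis enters the engine in one place only: the class of the propagating cell must
be a sum of polarised Gram entries, i.e. must not be a doubled exponent `2 d_z`.  This file re-cuts the two engine pieces with that LOCAL
hypothesis (`exists_partner_pair_of_nondoubled`, `false_of_wild_tying_extremal_of_nondoubled`; proofs verbatim otherwise) and adds the
diagonal coefficient of a doubled exponent carrying no pair (`coeff_diag_of_noPair`), so that the sequels `…TameRoof` / `…TameLaw`
can treat supports WITH three-term progressions: there the bound `npEdges ≤ 3K − 4` survives as long as every PROGRESSION CLASS
`2 d_z = d_x + d_w` is tame (its letter determinant `det S_z` and its entries `G_{xw}` are `v`-bounded by the class coefficient) — the exact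
complement of the ✓ `valNonSidonFive` mechanism.  Nothing here is a stub of the line or closes anything; no bearing on vW / vB,
`TropicalB`, `MatrixDescartes` (18050) or VP ≠ VNP.  [elementary; ultrametric + Gram rank 3]
-/

set_option linter.dupNamespace false
set_option autoImplicit false

namespace Summit.ValiantsHypothesis.ValiantsHypothesis.Theorems.KPlusLogSqLaw.ValDoor

open Polynomial Finset Matrix
open scoped BigOperators Classical

variable {F : Type*} [Field F]

/-! ## §1 Coefficients and partners for classes without a diagonal cell -/

/-- if the doubled exponent `2 d_i` carries NO PAIR (`d_x + d_w ≠ 2 d_i` for `x ≠ w`; injective support) the diagonal coefficient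
at `2 d_i` is the letter determinant `det S_i` (✓ `coeff_diag_of_apfree` without the global no-3-AP hypothesis). [bookkeeping] -/
theorem coeff_diag_of_noPair {K : ℕ} (d : Fin K → ℕ) (hd : Function.Injective d) (S : Fin K → Matrix (Fin 2) (Fin 2) F)
    (hS : ∀ l, (S l).IsSymm) (i : Fin K) (hno : ∀ x w : Fin K, x ≠ w → d x + d w ≠ d i + d i) :
    (Matrix.det (∑ l, ((X : F[X]) ^ d l) • (S l).map (C : F →+* F[X]))).coeff (d i + d i)
      = S i 0 0 * S i 1 1 - S i 0 1 * S i 0 1 := by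
  rw [coeff_det_symmPencil_two d S hS]
  have hfilter : (univ : Finset (Fin K × Fin K)).filter (fun p => d p.1 + d p.2 = d i + d i) = {(i, i)} := by
    ext p
    simp only [Finset.mem_filter, Finset.mem_univ, true_and, Finset.mem_singleton]
    constructor
    · intro h
      by_cases hpq : p.1 = p.2
      · have h1 : d p.1 = d i := by rw [← hpq] at h; omega
        have h2 := hd h1
        exact Prod.ext h2 (by rw [← hpq]; exact h2)
      · exact absurd h (hno p.1 p.2 hpq)
    · rintro rfl; rfl
  rw [hfilter, Finset.sum_singleton]

/-- **a cancelling pair has a partner:** if the class coefficient at a NON-DOUBLED exponent `d_i + d_j` (`i < j`) vanishes or is `v`-smaller than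
the nonzero entry `G_{ij} = a_i c_j + a_j c_i − 2 b_i b_j`, then another pair `i' < j'` of the same class has `v(G_{i'j'}) ≥ v(G_{ij})`
(ultrametric: a sum with a unique `v`-largest term has that absolute value). [elementary] -/
theorem exists_partner_pair_of_nondoubled (v : AbsoluteValue F ℝ) (hv : IsNonarchimedean v) {K : ℕ} (d : Fin K → ℕ)
    (S : Fin K → Matrix (Fin 2) (Fin 2) F) (hS : ∀ l, (S l).IsSymm)
    {i j : Fin K} (hij : i < j) (hE : ∀ l : Fin K, d l + d l ≠ d i + d j)
    (hG : S i 0 0 * S j 1 1 + S j 0 0 * S i 1 1 - 2 * S i 0 1 * S j 0 1 ≠ 0)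
    (hwild : (Matrix.det (∑ l, ((X : F[X]) ^ d l) • (S l).map (C : F →+* F[X]))).coeff (d i + d j) = 0 ∨
      v ((Matrix.det (∑ l, ((X : F[X]) ^ d l) • (S l).map (C : F →+* F[X]))).coeff (d i + d j))
        < v (S i 0 0 * S j 1 1 + S j 0 0 * S i 1 1 - 2 * S i 0 1 * S j 0 1)) :
    ∃ i' j' : Fin K, i' < j' ∧ (i', j') ≠ (i, j) ∧ d i' + d j' = d i + d j ∧
      v (S i 0 0 * S j 1 1 + S j 0 0 * S i 1 1 - 2 * S i 0 1 * S j 0 1)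
        ≤ v (S i' 0 0 * S j' 1 1 + S j' 0 0 * S i' 1 1 - 2 * S i' 0 1 * S j' 0 1) := by
  by_contra hno
  push Not at hno
  set T := (univ : Finset (Fin K × Fin K)).filter (fun p => p.1 < p.2 ∧ d p.1 + d p.2 = d i + d j) with hT
  have hmem : (i, j) ∈ T := Finset.mem_filter.2 ⟨Finset.mem_univ _, hij, rfl⟩
  have huniq := abv_sum_eq_of_unique_max v hv T
    (fun p : Fin K × Fin K => S p.1 0 0 * S p.2 1 1 + S p.2 0 0 * S p.1 1 1 - 2 * S p.1 0 1 * S p.2 0 1) hmem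
    (fun p hp hne => by
      obtain ⟨-, hp1, hp2⟩ := Finset.mem_filter.1 hp
      have h := hno p.1 p.2 hp1 (by rwa [Prod.mk.eta]) hp2
      exact h)
  rw [← coeff_eq_sum_polar d S hS hE] at huniq
  rcases hwild with h0 | hlt
  · rw [h0, map_zero] at huniq
    exact hG (v.eq_zero.1 huniq.symm)
  · exact absurd huniq (ne_of_lt hlt)

/-! ## §2 The propagation engine, non-doubled form -/

/-- **PROPAGATION ENGINE, non-doubled form (no extremal wild tying cell of a class without a diagonal cell).**  Fix a concave
roof `h t = min (p + q t) (p' + q' t)` and a level `μ` such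
that every nonzero polarised Gram entry `G_{ij} = a_i c_j + a_j c_i − 2 b_i b_j` has `log v(G_{ij}) ≤ h(d_i + d_j) + μ`.  Then no TYING
entry (`=`) `G_{a₀e₀}`, `a₀ < e₀`, whose class cancels (the coefficient at `d_{a₀} + d_{e₀}` vanishes or is `v`-smaller than
`G_{a₀e₀}`) can
be EXTREMAL (every tying entry has class exponent `≤ d_{a₀} + d_{e₀}`, or every one has `≥`).  Proof: a partner pair of the class ties
too (`exists_partner_pair`); the two pairs are nested, `p < q < r < s` with `d_p + d_s = d_q + d_r = G*`; in the singular `4 × 4` Gram minor of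
`p, q, r, s` (✓ `det_gram_polarDet_eq_zero`) the reversal term has `log v = 4 (h(G*) + μ)`, and any other Leibniz term is
`≤ Σ roof + Σ slack ≤ 4 h(G*) + 4 μ` (✓ `sum_perm_le_sum_rev`) with equality only if its four cells all tie, hence all have exponent
`≤ G*` (or all `≥ G*`) with mean `G*`, hence all `= G*`, hence the term is the reversal — so the reversal is the unique `v`-largest term of
a vanishing sum (✓ `abv_sum_eq_of_unique_max`), contradiction.  No 3-AP is used only through `exists_partner_pair`. [the heart] -/
theorem false_of_wild_tying_extremal_of_nondoubled (v : AbsoluteValue F ℝ) (hv : IsNonarchimedean v) {K : ℕ}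
    (d : Fin K → ℕ) (hd : StrictMono d) (S : Fin K → Matrix (Fin 2) (Fin 2) F) (hS : ∀ l, (S l).IsSymm)
    (p q p' q' μ : ℝ)
    (hle : ∀ i j : Fin K, S i 0 0 * S j 1 1 + S j 0 0 * S i 1 1 - 2 * S i 0 1 * S j 0 1 ≠ 0 →
      Real.log (v (S i 0 0 * S j 1 1 + S j 0 0 * S i 1 1 - 2 * S i 0 1 * S j 0 1))
        ≤ min (p + q * ((d i + d j : ℕ) : ℝ)) (p' + q' * ((d i + d j : ℕ) : ℝ)) + μ)
    {a₀ e₀ : Fin K} (hae₀ : a₀ < e₀) (hE₀ : ∀ l : Fin K, d l + d l ≠ d a₀ + d e₀)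
    (hG0 : S a₀ 0 0 * S e₀ 1 1 + S e₀ 0 0 * S a₀ 1 1 - 2 * S a₀ 0 1 * S e₀ 0 1 ≠ 0)
    (htie : Real.log (v (S a₀ 0 0 * S e₀ 1 1 + S e₀ 0 0 * S a₀ 1 1 - 2 * S a₀ 0 1 * S e₀ 0 1))
        = min (p + q * ((d a₀ + d e₀ : ℕ) : ℝ)) (p' + q' * ((d a₀ + d e₀ : ℕ) : ℝ)) + μ)
    (hwild : (Matrix.det (∑ l, ((X : F[X]) ^ d l) • (S l).map (C : F →+* F[X]))).coeff (d a₀ + d e₀) = 0 ∨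
      v ((Matrix.det (∑ l, ((X : F[X]) ^ d l) • (S l).map (C : F →+* F[X]))).coeff (d a₀ + d e₀))
        < v (S a₀ 0 0 * S e₀ 1 1 + S e₀ 0 0 * S a₀ 1 1 - 2 * S a₀ 0 1 * S e₀ 0 1))
    (hdir : (∀ i j : Fin K, S i 0 0 * S j 1 1 + S j 0 0 * S i 1 1 - 2 * S i 0 1 * S j 0 1 ≠ 0 →
        Real.log (v (S i 0 0 * S j 1 1 + S j 0 0 * S i 1 1 - 2 * S i 0 1 * S j 0 1))
          = min (p + q * ((d i + d j : ℕ) : ℝ)) (p' + q' * ((d i + d j : ℕ) : ℝ)) + μ → d i + d j ≤ d a₀ + d e₀) ∨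
      (∀ i j : Fin K, S i 0 0 * S j 1 1 + S j 0 0 * S i 1 1 - 2 * S i 0 1 * S j 0 1 ≠ 0 →
        Real.log (v (S i 0 0 * S j 1 1 + S j 0 0 * S i 1 1 - 2 * S i 0 1 * S j 0 1))
          = min (p + q * ((d i + d j : ℕ) : ℝ)) (p' + q' * ((d i + d j : ℕ) : ℝ)) + μ → d a₀ + d e₀ ≤ d i + d j)) :
    False := by
  set Gm : Fin K → Fin K → F := fun i j => S i 0 0 * S j 1 1 + S j 0 0 * S i 1 1 - 2 * S i 0 1 * S j 0 1 with hGm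
  set h : ℝ → ℝ := fun t => min (p + q * t) (p' + q' * t) with hh
  have hle' : ∀ i j, Gm i j ≠ 0 → Real.log (v (Gm i j)) ≤ h ((d i + d j : ℕ) : ℝ) + μ := fun i j hG => hle i j hG
  have htie_iff : ∀ i j, (Gm i j ≠ 0 ∧ Real.log (v (Gm i j)) = h ((d i + d j : ℕ) : ℝ) + μ) →
      (d i + d j ≤ d a₀ + d e₀ ∧ ∀ i₁ j₁, Gm i₁ j₁ ≠ 0 → Real.log (v (Gm i₁ j₁)) = h ((d i₁ + d j₁ : ℕ) : ℝ) + μ →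
          d i₁ + d j₁ ≤ d a₀ + d e₀) ∨
      (d a₀ + d e₀ ≤ d i + d j ∧ ∀ i₁ j₁, Gm i₁ j₁ ≠ 0 → Real.log (v (Gm i₁ j₁)) = h ((d i₁ + d j₁ : ℕ) : ℝ) + μ →
          d a₀ + d e₀ ≤ d i₁ + d j₁) := by
    intro i j hij
    rcases hdir with hdir | hdir
    · exact Or.inl ⟨hdir i j hij.1 hij.2, fun i₁ j₁ h1 h2 => hdir i₁ j₁ h1 h2⟩
    · exact Or.inr ⟨hdir i j hij.1 hij.2, fun i₁ j₁ h1 h2 => hdir i₁ j₁ h1 h2⟩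
  have hGsymm : ∀ i j, Gm i j = Gm j i := fun i j => by simp only [hGm]; ring
  have hG0' : Gm a₀ e₀ ≠ 0 := hG0
  have htie0 : Real.log (v (Gm a₀ e₀)) = h ((d a₀ + d e₀ : ℕ) : ℝ) + μ := htie
  -- the partner pair
  obtain ⟨i', j', hij', hne', hsum', hvle⟩ := exists_partner_pair_of_nondoubled v hv d S hS hae₀ hE₀ hG0 hwild
  have hvle' : v (Gm a₀ e₀) ≤ v (Gm i' j') := hvle
  have hG1 : Gm i' j' ≠ 0 := by
    intro h0
    have h1 : v (Gm i' j') = 0 := by rw [h0, map_zero]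
    have h2 : 0 < v (Gm a₀ e₀) := v.pos hG0'
    linarith
  have htie1 : Real.log (v (Gm i' j')) = h ((d a₀ + d e₀ : ℕ) : ℝ) + μ := by
    refine le_antisymm ?_ ?_
    · have := hle' i' j' hG1
      rwa [hsum'] at this
    · rw [← htie0]
      exact Real.log_le_log (v.pos hG0') hvle'
  -- the nested quadruple `a < b < c < e`, outer and inner pair both tying and nonzero
  obtain ⟨a, b, c, e, hab, hbc, hce, hsae, hsbc, hGae, hGbc, htae, htbc⟩ :
      ∃ a b c e : Fin K, a < b ∧ b < c ∧ c < e ∧ d a + d e = d a₀ + d e₀ ∧ d b + d c = d a₀ + d e₀ ∧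
        Gm a e ≠ 0 ∧ Gm b c ≠ 0 ∧ Real.log (v (Gm a e)) = h ((d a₀ + d e₀ : ℕ) : ℝ) + μ ∧
        Real.log (v (Gm b c)) = h ((d a₀ + d e₀ : ℕ) : ℝ) + μ := by
    have hne0 : a₀ ≠ i' := by
      intro h0
      apply hne'
      subst h0
      have : d j' = d e₀ := by omega
      rw [hd.injective this]
    rcases lt_or_gt_of_ne hne0 with h0 | h0
    · have h1 : d a₀ < d i' := hd h0
      have h2 : j' < e₀ := hd.lt_iff_lt.1 (by omega)
      exact ⟨a₀, i', j', e₀, h0, hij', h2, rfl, hsum', hG0', hG1, htie0, htie1⟩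
    · have h1 : d i' < d a₀ := hd h0
      have h2 : e₀ < j' := hd.lt_iff_lt.1 (by omega)
      exact ⟨i', a₀, e₀, j', h0, hae₀, h2, hsum', rfl, hG1, hG0', htie1, htie0⟩
  set Gs : ℕ := d a₀ + d e₀ with hGs
  have hda : d a < d b := hd hab
  have hdb : d b < d c := hd hbc
  have hdc : d c < d e := hd hce
  -- the four letters
  set ι : Fin 4 → Fin K := ![a, b, c, e] with hι
  have hι0 : ι 0 = a := rfl
  have hι1 : ι 1 = b := rfl
  have hι2 : ι 2 = c := rfl
  have hι3 : ι 3 = e := rfl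
  have hmono : StrictMono (d ∘ ι) := by
    refine Fin.strictMono_iff_lt_succ.2 fun i => ?_
    fin_cases i
    · exact hda
    · exact hdb
    · exact hdc
  -- which cells of the quadruple have sum `Gs`
  have hkey : ∀ i j : Fin 4, d (ι i) + d (ι j) = Gs → i = Fin.revPerm j := by
    intro i j hs
    have e0 : ∀ h0 : 0 < 4, ι ⟨0, h0⟩ = a := fun _ => rfl
    have e1 : ∀ h0 : 1 < 4, ι ⟨1, h0⟩ = b := fun _ => rfl
    have e2 : ∀ h0 : 2 < 4, ι ⟨2, h0⟩ = c := fun _ => rfl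
    have e3 : ∀ h0 : 3 < 4, ι ⟨3, h0⟩ = e := fun _ => rfl
    apply Fin.ext
    rw [Fin.revPerm_apply, Fin.val_rev]
    rcases i with ⟨iv, hiv⟩
    rcases j with ⟨jv, hjv⟩
    simp only
    interval_cases iv <;> interval_cases jv <;> simp only [e0, e1, e2, e3] at hs <;> omega
  have hrev_sum : ∀ l : Fin 4, d (ι (Fin.revPerm l)) + d (ι l) = Gs := by
    intro l
    fin_cases l
    · show d (ι 3) + d (ι 0) = Gs; rw [hι3, hι0, Nat.add_comm]; exact hsae
    · show d (ι 2) + d (ι 1) = Gs; rw [hι2, hι1, Nat.add_comm]; exact hsbc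
    · show d (ι 1) + d (ι 2) = Gs; rw [hι1, hι2]; exact hsbc
    · show d (ι 0) + d (ι 3) = Gs; rw [hι0, hι3]; exact hsae
  have hrev_cell : ∀ l : Fin 4, Gm (ι (Fin.revPerm l)) (ι l) ≠ 0 ∧
      Real.log (v (Gm (ι (Fin.revPerm l)) (ι l))) = h ((Gs : ℕ) : ℝ) + μ := by
    intro l
    fin_cases l
    · show Gm (ι 3) (ι 0) ≠ 0 ∧ Real.log (v (Gm (ι 3) (ι 0))) = h ((Gs : ℕ) : ℝ) + μ
      rw [hι3, hι0, hGsymm e a]; exact ⟨hGae, htae⟩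
    · show Gm (ι 2) (ι 1) ≠ 0 ∧ Real.log (v (Gm (ι 2) (ι 1))) = h ((Gs : ℕ) : ℝ) + μ
      rw [hι2, hι1, hGsymm c b]; exact ⟨hGbc, htbc⟩
    · show Gm (ι 1) (ι 2) ≠ 0 ∧ Real.log (v (Gm (ι 1) (ι 2))) = h ((Gs : ℕ) : ℝ) + μ
      rw [hι1, hι2]; exact ⟨hGbc, htbc⟩
    · show Gm (ι 0) (ι 3) ≠ 0 ∧ Real.log (v (Gm (ι 0) (ι 3))) = h ((Gs : ℕ) : ℝ) + μ
      rw [hι0, hι3]; exact ⟨hGae, htae⟩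
  -- the Gram minor and its Leibniz terms
  set G : Matrix (Fin 4) (Fin 4) F :=
    Matrix.of fun i j : Fin 4 => S (ι i) 0 0 * S (ι j) 1 1 + S (ι j) 0 0 * S (ι i) 1 1 - 2 * S (ι i) 0 1 * S (ι j) 0 1 with hG
  have hdet : G.det = 0 := det_gram_polarDet_eq_zero (fun i => S (ι i) 0 0) (fun i => S (ι i) 0 1) (fun i => S (ι i) 1 1)
  have hGG : ∀ i j, G i j = Gm (ι i) (ι j) := fun i j => by rw [hG, Matrix.of_apply]
  have hterm : ∀ σ : Equiv.Perm (Fin 4), v (Equiv.Perm.sign σ • ∏ l, G (σ l) l) = ∏ l, v (G (σ l) l) := by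
    intro σ
    rcases Int.units_eq_one_or (Equiv.Perm.sign σ) with h1 | h1
    · rw [h1, one_smul, map_prod]
    · rw [h1, Units.neg_smul, one_smul, AbsoluteValue.map_neg, map_prod]
  -- the roof table on the quadruple and its weak concavity along equal sums
  set x : Fin 4 → Fin 4 → ℝ := fun i j => h ((d (ι i) + d (ι j) : ℕ) : ℝ) with hx
  have hxsymm : ∀ i j, x i j = x j i := fun i j => by simp only [hx, Nat.add_comm]
  have hconc : ∀ p₁ q₁ p₂ q₂ p₃ q₃ p₄ q₄ : Fin 4,
      (d ∘ ι) p₁ + (d ∘ ι) q₁ + ((d ∘ ι) p₄ + (d ∘ ι) q₄) = (d ∘ ι) p₂ + (d ∘ ι) q₂ + ((d ∘ ι) p₃ + (d ∘ ι) q₃) →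
      (d ∘ ι) p₁ + (d ∘ ι) q₁ < (d ∘ ι) p₂ + (d ∘ ι) q₂ → (d ∘ ι) p₁ + (d ∘ ι) q₁ < (d ∘ ι) p₃ + (d ∘ ι) q₃ →
      x p₁ q₁ + x p₄ q₄ ≤ x p₂ q₂ + x p₃ q₃ := by
    intro p₁ q₁ p₂ q₂ p₃ q₃ p₄ q₄ hsum h12 h13
    simp only [Function.comp_apply] at hsum h12 h13
    simp only [hx, hh]
    refine min_affine_outer_le_inner _ _ _ _ _ _ _ _ ?_ ?_ ?_
    · exact_mod_cast h12.le
    · exact_mod_cast h13.le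
    · exact_mod_cast hsum
  -- the reversal term
  have heq : ∏ l, v (G (Fin.revPerm l) l) = Real.exp (∑ l : Fin 4, (x (Fin.revPerm l) l + μ)) := by
    rw [Real.exp_sum]
    refine Finset.prod_congr rfl fun l _ => ?_
    rw [hGG]
    have h1 := (hrev_cell l).2
    have h2 : x (Fin.revPerm l) l = h ((Gs : ℕ) : ℝ) := by simp only [hx]; rw [hrev_sum l]
    rw [h2, ← h1, Real.exp_log (v.pos (hrev_cell l).1)]
  -- every other term is strictly smaller
  have hmax : ∀ σ ∈ (univ : Finset (Equiv.Perm (Fin 4))), σ ≠ Fin.revPerm →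
      v (Equiv.Perm.sign σ • ∏ l, G (σ l) l)
        < v (Equiv.Perm.sign (Fin.revPerm : Equiv.Perm (Fin 4)) • ∏ l, G ((Fin.revPerm : Equiv.Perm (Fin 4)) l) l) := by
    intro σ _ hσ
    rw [hterm, hterm, heq]
    by_cases hz : ∃ l, G (σ l) l = 0
    · obtain ⟨l, hl⟩ := hz
      rw [Finset.prod_eq_zero (Finset.mem_univ l) (by rw [hl, map_zero])]
      exact Real.exp_pos _
    push Not at hz
    have hz' : ∀ l, Gm (ι (σ l)) (ι l) ≠ 0 := fun l => by rw [← hGG]; exact hz l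
    have hprod : ∏ l, v (G (σ l) l) = Real.exp (∑ l, Real.log (v (G (σ l) l))) := by
      rw [Real.exp_sum]
      exact Finset.prod_congr rfl fun l _ => (Real.exp_log (v.pos (hz l))).symm
    rw [hprod]
    refine Real.exp_lt_exp.2 ?_
    have hle_l : ∀ l, Real.log (v (G (σ l) l)) ≤ x (σ l) l + μ := fun l => by
      rw [hGG]; exact hle' _ _ (hz' l)
    have hroof : ∑ l, (x (σ l) l + μ) ≤ ∑ l, (x (Fin.revPerm l) l + μ) := by
      simp only [Finset.sum_add_distrib, add_le_add_iff_right]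
      calc ∑ l, x (σ l) l = ∑ l, x l (σ l) := Finset.sum_congr rfl fun l _ => hxsymm _ _
        _ ≤ ∑ l, x l (Fin.revPerm l) := sum_perm_le_sum_rev x (d ∘ ι) (d ∘ ι) hmono hmono hconc _ σ le_rfl
        _ = ∑ l, x (Fin.revPerm l) l := Finset.sum_congr rfl fun l _ => hxsymm _ _
    by_cases hall : ∀ l, Real.log (v (G (σ l) l)) = x (σ l) l + μ
    · -- all four cells tie: they all have exponent `Gs`, so `σ` is the reversal
      exfalso
      have hall' : ∀ l, Real.log (v (Gm (ι (σ l)) (ι l))) = h ((d (ι (σ l)) + d (ι l) : ℕ) : ℝ) + μ := fun l => by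
        rw [← hGG]; exact hall l
      have hsumι : ∑ l : Fin 4, (d (ι (σ l)) + d (ι l)) = 4 * Gs := by
        rw [Finset.sum_add_distrib, Equiv.sum_comp σ (fun l => d (ι l)), ← two_mul, Fin.sum_univ_four, hι0, hι1, hι2,
          hι3]
        omega
      have hallGs : ∀ l, d (ι (σ l)) + d (ι l) = Gs := by
        rcases htie_iff (ι (σ 0)) (ι 0) ⟨hz' 0, hall' 0⟩ with ⟨-, hdir'⟩ | ⟨-, hdir'⟩
        · have hle4 : ∀ l, d (ι (σ l)) + d (ι l) ≤ Gs := fun l => hdir' _ _ (hz' l) (hall' l)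
          by_contra hno
          push Not at hno
          obtain ⟨l₀, hl₀⟩ := hno
          have hlt : d (ι (σ l₀)) + d (ι l₀) < Gs := lt_of_le_of_ne (hle4 l₀) hl₀
          have := Finset.sum_lt_sum (fun l (_ : l ∈ (univ : Finset (Fin 4))) => hle4 l) ⟨l₀, Finset.mem_univ _, hlt⟩
          simp only [Finset.sum_const, Finset.card_univ, Fintype.card_fin, smul_eq_mul] at this
          omega
        · have hge4 : ∀ l, Gs ≤ d (ι (σ l)) + d (ι l) := fun l => hdir' _ _ (hz' l) (hall' l)
          by_contra hno
          push Not at hno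
          obtain ⟨l₀, hl₀⟩ := hno
          have hlt : Gs < d (ι (σ l₀)) + d (ι l₀) := lt_of_le_of_ne (hge4 l₀) (Ne.symm hl₀)
          have := Finset.sum_lt_sum (fun l (_ : l ∈ (univ : Finset (Fin 4))) => hge4 l) ⟨l₀, Finset.mem_univ _, hlt⟩
          simp only [Finset.sum_const, Finset.card_univ, Fintype.card_fin, smul_eq_mul] at this
          omega
      apply hσ
      exact Equiv.ext fun l => hkey (σ l) l (hallGs l)
    · push Not at hall
      obtain ⟨l₀, hl₀⟩ := hall
      have hlt_l : Real.log (v (G (σ l₀) l₀)) < x (σ l₀) l₀ + μ := lt_of_le_of_ne (hle_l l₀) hl₀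
      calc ∑ l, Real.log (v (G (σ l) l)) < ∑ l, (x (σ l) l + μ) :=
            Finset.sum_lt_sum (fun l _ => hle_l l) ⟨l₀, Finset.mem_univ _, hlt_l⟩
        _ ≤ ∑ l, (x (Fin.revPerm l) l + μ) := hroof
  have hsum := abv_sum_eq_of_unique_max v hv (univ : Finset (Equiv.Perm (Fin 4)))
    (fun σ => Equiv.Perm.sign σ • ∏ l, G (σ l) l) (Finset.mem_univ (Fin.revPerm : Equiv.Perm (Fin 4))) hmax
  rw [← Matrix.det_apply, hdet, map_zero, hterm, heq] at hsum
  exact absurd hsum (ne_of_lt (Real.exp_pos _))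

end Summit.ValiantsHypothesis.ValiantsHypothesis.Theorems.KPlusLogSqLaw.ValDoor
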